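import Summits.RiemannHypothesis.RiemannHypothesis.Theorems.PfPersistenceWindowSlopes
import HarnessLib

/-!
# Danskin's theorem for the windowed Weil form: one-sided window derivatives of the bottom at
# EVERY small window (pub-rhpf, theory-1 gen 9; helper for crux `EvenSectorBarta.EvenOneSignedWindows`,
# item stmt-RiemannHypothesis-19953; RH-free)

**mechanism/rigidity campaign; no RH claims.**  Companion text:
`run/shared/lean/pub/pub-rhpf/pub-rhpf-theory-1/THEORY-EDGE-9.md`.

THE EDGE LAW, DANSKIN FORM (all PROVED here, for ζ's windowed form at every window
`0 < a < ½ log 2`; `ε = weilGroundEnergy`, `V(u) = weilSmallWindowVirial a u` the dilation virial of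
a ground state `u` of the window `a`):

* `exists_isWeilGroundState_hasDerivWithinAt_Ioi`: there is a ground state `u⁺` MAXIMISING `V`
  over the ground states of `a`, and `ε` has the RIGHT derivative `−V(u⁺)/a` at `a`;
* `exists_isWeilGroundState_hasDerivWithinAt_Iio`: there is a ground state `u⁻` MINIMISING `V`,
  and `ε` has the LEFT derivative `−V(u⁻)/a` at `a`;
* `exists_hasDerivWithinAt_weilGroundEnergy_Ioi_Iio`: hence both one-sided derivatives exist at
  every small window and `∂₊ε(a) ≤ ∂₋ε(a)` (a concave corner of size `(max V − min V)/a`);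
* `differentiableAt_weilGroundEnergy_iff`: `ε` is differentiable at `a` **iff** all ground states
  of `a` have the same virial; then `ε'(a) = −V(w)/a` for every ground state `w`
  (`hasDerivAt_weilGroundEnergy_of_virial_eq`, `mul_deriv_weilGroundEnergy_eq_neg_virial_of_virial_eq`).

This upgrades the Dini bracket `∂⁺ε(a) ≤ −V(u)/a ≤ ∂₋ε(a)` of `PfPersistenceEdgeLawDini` (one ground
state, inequalities) to EQUALITIES with extremal ground states, and removes the hypothesis
`DifferentiableAt ℝ weilGroundEnergy a` from the edge law `a ε'(a) = −V(u)`
(`PfPersistenceProfileDeriv`) whenever the virial is constant on the ground states — in particular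
under uniqueness of the ground state. STRUCTURE versus ARITHMETIC: everything here holds for the
windowed form as a variational object (compactness of minimising sequences, strong continuity of
the dilation group, the orbit mean-value theorem, continuity of the closed virial); the one input
that is not structure is whether `{V(u) : u ground state of a}` is a singleton.

METHOD: Lemma S (`exists_isWeilGroundState_slope_bound`, `PfPersistenceWindowSlopes`) bounds the
difference quotients along any window sequence from one side by normalised virials converging to
`−V(u)/a` for a ground state `u` the sequence produces; the Dini envelope bounds of
`PfPersistenceEdgeLawDini` bound them from the other side for EVERY ground state; comparing the two
along one probing sequence shows that the produced `u` is extremal, and then the two bounds pinch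
(`tendsto_order`, `hasDerivWithinAt_iff_tendsto_slope'`; the lower bound for a general sequence is
obtained by contradiction through `Filter.exists_seq_forall_of_frequently` and Lemma S again).

References: J. M. Danskin, *The theory of Max-Min, with applications*, SIAM J. Appl. Math. 14
(1966) 641–664, Thm 1; T. Kato, *Perturbation Theory for Linear Operators* (1966), II §6.4,
VII §4, VII §6.5; A. Connes, C. Consani, H. Moscovici (2025), Thm 3.6.
-/

set_option linter.dupNamespace false

noncomputable section

open MeasureTheory Set Filter Metric
open scoped Topology

namespace Summit.RiemannHypothesis.RiemannHypothesis.Theorems.PfPersistence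

open Literature.NumberTheory.LFunctions

/-! ## §1 Danskin's theorem for the window energy -/

/-- **Danskin's theorem for the windowed Weil form — right side.** At every window
`0 < a < ½ log 2` there is a ground state `u⁺` MAXIMISING the dilation virial over the ground
states of the window, and the bottom `ε = weilGroundEnergy` has the RIGHT derivative
`−V(u⁺)/a` at `a`: `∂₊ε(a) = −max_{u} V(u)/a`. [cite: Danskin1966, Thm 1; Kato1966, VII §4] -/
theorem exists_isWeilGroundState_hasDerivWithinAt_Ioi {a : ℝ} (ha : 0 < a)
    (ha2 : a < Real.log 2 / 2) :
    ∃ u : ℝ → ℂ, IsWeilGroundState a u ∧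
      (∀ v, IsWeilGroundState a v → weilSmallWindowVirial a v ≤ weilSmallWindowVirial a u) ∧
      HasDerivWithinAt weilGroundEnergy (-weilSmallWindowVirial a u / a) (Ioi a) a := by
  obtain ⟨L, hLdef⟩ : ∃ L : ℝ, L = (a + Real.log 2 / 2) / 2 := ⟨_, rfl⟩
  have haL : a < L := by rw [hLdef]; linarith
  have hL : L < Real.log 2 / 2 := by rw [hLdef]; linarith
  -- a probing sequence from the right
  obtain ⟨b, hbdef⟩ : ∃ b : ℕ → ℝ, ∀ n, b n = a + (L - a) * (1 / ((n : ℝ) + 1)) :=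
    ⟨_, fun _ ↦ rfl⟩
  have hbgt : ∀ n, a < b n := fun n ↦ by
    rw [hbdef]
    have : (0 : ℝ) < 1 / ((n : ℝ) + 1) := by positivity
    nlinarith
  have hbL : ∀ n, b n ≤ L := fun n ↦ by
    rw [hbdef]
    have h1 : 1 / ((n : ℝ) + 1) ≤ 1 := (div_le_one (by positivity)).2 (by linarith [n.cast_nonneg (α := ℝ)])
    nlinarith
  have hb : Tendsto b atTop (𝓝 a) := by
    have h1 := (tendsto_one_div_add_atTop_nhds_zero_nat.const_mul (L - a)).const_add a
    rw [mul_zero, add_zero] at h1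
    exact h1.congr fun n ↦ (hbdef n).symm
  obtain ⟨u, φ, r, hu, hφ, hr, hineq⟩ := exists_isWeilGroundState_slope_bound ha haL.le hL
    (fun n ↦ ha.trans (hbgt n)) hbL (fun n ↦ (hbgt n).ne') hb
  have hsl : ∀ n, r n ≤ slope weilGroundEnergy a (b (φ n)) := fun n ↦
    sub_nonneg.1 ((mul_nonneg_iff_of_pos_left (sub_pos.2 (hbgt (φ n)))).1 (hineq n))
  have hbφ : Tendsto (fun n ↦ b (φ n)) atTop (𝓝[>] a) :=
    tendsto_nhdsWithin_iff.2 ⟨hb.comp hφ.tendsto_atTop, Eventually.of_forall fun n ↦ hbgt _⟩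
  -- (i) `u` maximises the virial
  have hmax : ∀ v, IsWeilGroundState a v →
      weilSmallWindowVirial a v ≤ weilSmallWindowVirial a u := by
    intro v hv
    by_contra hlt
    push Not at hlt
    have hs : -weilSmallWindowVirial a v / a < -weilSmallWindowVirial a u / a :=
      div_lt_div_of_pos_right (by linarith) ha
    obtain ⟨s, hs1, hs2⟩ := exists_between hs
    have h1 : ∀ᶠ n in atTop, slope weilGroundEnergy a (b (φ n)) < s :=
      hbφ.eventually (slope_weilGroundEnergy_lt_eventually hv
        (hasDerivAt_weilDilationProfile_of_lt hv ha2).hasDerivWithinAt hs1)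
    have h2 : ∀ᶠ n in atTop, s < r n := hr.eventually (lt_mem_nhds hs2)
    obtain ⟨n, hn1, hn2⟩ := (h1.and h2).exists
    linarith [hsl n]
  refine ⟨u, hu, hmax, ?_⟩
  -- (ii) the right derivative
  rw [hasDerivWithinAt_iff_tendsto_slope' (show a ∉ Ioi a from lt_irrefl a)]
  refine tendsto_order.2 ⟨fun s hs ↦ ?_, fun s hs ↦ ?_⟩
  · by_contra hcon
    have hfr : ∃ᶠ c in 𝓝[>] a, slope weilGroundEnergy a c ≤ s := by
      simpa only [not_eventually, not_lt] using hcon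
    obtain ⟨c, hc, hcs⟩ := exists_seq_forall_of_frequently hfr
    obtain ⟨hc1, hc2⟩ := tendsto_nhdsWithin_iff.1 hc
    obtain ⟨N, hN⟩ := eventually_atTop.1 (hc2.and (hc1.eventually (Iio_mem_nhds haL)))
    have hNa : ∀ n, a < c (n + N) := fun n ↦ (hN _ (N.le_add_left n)).1
    have hNL : ∀ n, c (n + N) < L := fun n ↦ (hN _ (N.le_add_left n)).2
    obtain ⟨u', φ', r', hu', -, hr', hineq'⟩ := exists_isWeilGroundState_slope_bound ha haL.le
      hL (b := fun n ↦ c (n + N)) (fun n ↦ ha.trans (hNa n)) (fun n ↦ (hNL n).le)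
      (fun n ↦ (hNa n).ne') (hc1.comp (tendsto_add_atTop_nat N))
    have hD : s < -weilSmallWindowVirial a u' / a :=
      lt_of_lt_of_le hs (div_le_div_of_nonneg_right (neg_le_neg (hmax u' hu')) ha.le)
    obtain ⟨n, hn⟩ := (hr'.eventually (lt_mem_nhds hD)).exists
    have h4 : r' n ≤ slope weilGroundEnergy a (c (φ' n + N)) :=
      sub_nonneg.1 ((mul_nonneg_iff_of_pos_left (sub_pos.2 (hNa (φ' n)))).1 (hineq' n))
    linarith [hcs (φ' n + N)]
  · exact slope_weilGroundEnergy_lt_eventually hu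
      (hasDerivAt_weilDilationProfile_of_lt hu ha2).hasDerivWithinAt hs

/-- **Danskin's theorem for the windowed Weil form — left side.** At every window
`0 < a < ½ log 2` there is a ground state `u⁻` MINIMISING the dilation virial over the ground
states of the window, and the bottom has the LEFT derivative `−V(u⁻)/a` at `a`:
`∂₋ε(a) = −min_{u} V(u)/a`. [cite: Danskin1966, Thm 1; Kato1966, VII §4] -/
theorem exists_isWeilGroundState_hasDerivWithinAt_Iio {a : ℝ} (ha : 0 < a)
    (ha2 : a < Real.log 2 / 2) :
    ∃ u : ℝ → ℂ, IsWeilGroundState a u ∧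
      (∀ v, IsWeilGroundState a v → weilSmallWindowVirial a u ≤ weilSmallWindowVirial a v) ∧
      HasDerivWithinAt weilGroundEnergy (-weilSmallWindowVirial a u / a) (Iio a) a := by
  -- a probing sequence from the left
  obtain ⟨b, hbdef⟩ : ∃ b : ℕ → ℝ, ∀ n, b n = a - a / 2 * (1 / ((n : ℝ) + 1)) :=
    ⟨_, fun _ ↦ rfl⟩
  have hblt : ∀ n, b n < a := fun n ↦ by
    rw [hbdef]
    have : (0 : ℝ) < 1 / ((n : ℝ) + 1) := by positivity
    nlinarith
  have hb0 : ∀ n, 0 < b n := fun n ↦ by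
    rw [hbdef]
    have h1 : 1 / ((n : ℝ) + 1) ≤ 1 := (div_le_one (by positivity)).2 (by linarith [n.cast_nonneg (α := ℝ)])
    nlinarith
  have hb : Tendsto b atTop (𝓝 a) := by
    have h1 := (tendsto_one_div_add_atTop_nhds_zero_nat.const_mul (a / 2)).const_sub a
    rw [mul_zero, sub_zero] at h1
    exact h1.congr fun n ↦ (hbdef n).symm
  obtain ⟨u, φ, r, hu, hφ, hr, hineq⟩ := exists_isWeilGroundState_slope_bound ha le_rfl ha2
    hb0 (fun n ↦ (hblt n).le) (fun n ↦ (hblt n).ne) hb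
  have hsl : ∀ n, slope weilGroundEnergy a (b (φ n)) ≤ r n := fun n ↦ by
    have h1 := hineq n
    have e : (b (φ n) - a) * (slope weilGroundEnergy a (b (φ n)) - r n) =
        (a - b (φ n)) * (r n - slope weilGroundEnergy a (b (φ n))) := by ring
    rw [e] at h1
    exact sub_nonneg.1 ((mul_nonneg_iff_of_pos_left (sub_pos.2 (hblt (φ n)))).1 h1)
  have hbφ : Tendsto (fun n ↦ b (φ n)) atTop (𝓝[<] a) :=
    tendsto_nhdsWithin_iff.2 ⟨hb.comp hφ.tendsto_atTop, Eventually.of_forall fun n ↦ hblt _⟩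
  -- (i) `u` minimises the virial
  have hmin : ∀ v, IsWeilGroundState a v →
      weilSmallWindowVirial a u ≤ weilSmallWindowVirial a v := by
    intro v hv
    by_contra hlt
    push Not at hlt
    have hs : -weilSmallWindowVirial a u / a < -weilSmallWindowVirial a v / a :=
      div_lt_div_of_pos_right (by linarith) ha
    obtain ⟨s, hs1, hs2⟩ := exists_between hs
    have h1 : ∀ᶠ n in atTop, s < slope weilGroundEnergy a (b (φ n)) :=
      hbφ.eventually (lt_slope_weilGroundEnergy_eventually hv
        (hasDerivAt_weilDilationProfile_of_lt hv ha2).hasDerivWithinAt hs2)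
    have h2 : ∀ᶠ n in atTop, r n < s := hr.eventually (gt_mem_nhds hs1)
    obtain ⟨n, hn1, hn2⟩ := (h1.and h2).exists
    linarith [hsl n]
  refine ⟨u, hu, hmin, ?_⟩
  -- (ii) the left derivative
  rw [hasDerivWithinAt_iff_tendsto_slope' (show a ∉ Iio a from lt_irrefl a)]
  refine tendsto_order.2 ⟨fun s hs ↦ ?_, fun s hs ↦ ?_⟩
  · exact lt_slope_weilGroundEnergy_eventually hu
      (hasDerivAt_weilDilationProfile_of_lt hu ha2).hasDerivWithinAt hs
  · by_contra hcon
    have hfr : ∃ᶠ c in 𝓝[<] a, s ≤ slope weilGroundEnergy a c := by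
      simpa only [not_eventually, not_lt] using hcon
    obtain ⟨c, hc, hcs⟩ := exists_seq_forall_of_frequently hfr
    obtain ⟨hc1, hc2⟩ := tendsto_nhdsWithin_iff.1 hc
    obtain ⟨N, hN⟩ := eventually_atTop.1 (hc2.and (hc1.eventually (Ioi_mem_nhds ha)))
    have hNa : ∀ n, c (n + N) < a := fun n ↦ (hN _ (N.le_add_left n)).1
    have hN0 : ∀ n, 0 < c (n + N) := fun n ↦ (hN _ (N.le_add_left n)).2
    obtain ⟨u', φ', r', hu', -, hr', hineq'⟩ := exists_isWeilGroundState_slope_bound ha le_rfl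
      ha2 (b := fun n ↦ c (n + N)) hN0 (fun n ↦ (hNa n).le) (fun n ↦ (hNa n).ne)
      (hc1.comp (tendsto_add_atTop_nat N))
    have hD : -weilSmallWindowVirial a u' / a < s :=
      lt_of_le_of_lt (div_le_div_of_nonneg_right (neg_le_neg (hmin u' hu')) ha.le) hs
    obtain ⟨n, hn⟩ := (hr'.eventually (gt_mem_nhds hD)).exists
    have h3 := hineq' n
    have e : (c (φ' n + N) - a) * (slope weilGroundEnergy a (c (φ' n + N)) - r' n) =
        (a - c (φ' n + N)) * (r' n - slope weilGroundEnergy a (c (φ' n + N))) := by ring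
    rw [e] at h3
    have h4 : slope weilGroundEnergy a (c (φ' n + N)) ≤ r' n :=
      sub_nonneg.1 ((mul_nonneg_iff_of_pos_left (sub_pos.2 (hNa (φ' n)))).1 h3)
    linarith [hcs (φ' n + N)]

/-! ## §2 Corollaries: the concave corner, and differentiability ⟺ equal virials -/

/-- **The bottom has both one-sided window derivatives at every small window, and the corner is
concave**: `∂₊ε(a) = −max V/a ≤ −min V/a = ∂₋ε(a)`. [cite: Danskin1966, Thm 1] -/
theorem exists_hasDerivWithinAt_weilGroundEnergy_Ioi_Iio {a : ℝ} (ha : 0 < a)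
    (ha2 : a < Real.log 2 / 2) :
    ∃ D₁ D₂ : ℝ, HasDerivWithinAt weilGroundEnergy D₁ (Ioi a) a ∧
      HasDerivWithinAt weilGroundEnergy D₂ (Iio a) a ∧ D₁ ≤ D₂ := by
  obtain ⟨u, hu, hmax, hD⟩ := exists_isWeilGroundState_hasDerivWithinAt_Ioi ha ha2
  obtain ⟨w, hw, -, hD'⟩ := exists_isWeilGroundState_hasDerivWithinAt_Iio ha ha2
  exact ⟨_, _, hD, hD', div_le_div_of_nonneg_right (neg_le_neg (hmax w hw)) ha.le⟩

/-- **Equal virials give the derivative.** If all ground states of a small window `a` have the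
same dilation virial then the bottom is differentiable at `a` with `ε'(a) = −V(w)/a` for every
ground state `w` (the two one-sided Danskin derivatives coincide). [cite: Danskin1966, Thm 1] -/
theorem hasDerivAt_weilGroundEnergy_of_virial_eq {a : ℝ} (ha : 0 < a) (ha2 : a < Real.log 2 / 2)
    (h : ∀ u v, IsWeilGroundState a u → IsWeilGroundState a v →
      weilSmallWindowVirial a u = weilSmallWindowVirial a v)
    {w : ℝ → ℂ} (hw : IsWeilGroundState a w) :
    HasDerivAt weilGroundEnergy (-weilSmallWindowVirial a w / a) a := by
  obtain ⟨u, hu, -, hD⟩ := exists_isWeilGroundState_hasDerivWithinAt_Ioi ha ha2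
  obtain ⟨v, hv, -, hD'⟩ := exists_isWeilGroundState_hasDerivWithinAt_Iio ha ha2
  rw [h u w hu hw] at hD
  rw [h v w hv hw] at hD'
  have h2 := hD'.union hD
  rw [Iio_union_Ioi, Set.compl_eq_univ_sdiff, hasDerivWithinAt_sdiff_singleton,
    hasDerivWithinAt_univ] at h2
  exact h2

/-- **Differentiability of the bottom at a small window ⟺ all its ground states have the same
dilation virial** (`→`: the corner theorem `not_differentiableAt_weilGroundEnergy_of_ne`;
`←`: Danskin). The only input that is NOT structure is thus whether the virial is constant on the
ground states of the window — in particular uniqueness of the ground state (Perron–Frobenius)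
suffices. [cite: Danskin1966, Thm 1; Kato1966, II §6.4 and VII §6.5] -/
theorem differentiableAt_weilGroundEnergy_iff {a : ℝ} (ha : 0 < a) (ha2 : a < Real.log 2 / 2) :
    DifferentiableAt ℝ weilGroundEnergy a ↔
      ∀ u v, IsWeilGroundState a u → IsWeilGroundState a v →
        weilSmallWindowVirial a u = weilSmallWindowVirial a v := by
  constructor
  · intro hd u v hu hv
    by_contra hne
    exact not_differentiableAt_weilGroundEnergy_of_ne hu hv ha2 hne hd
  · intro h
    obtain ⟨w, hw⟩ := ConnesConsaniMoscovici2025_thm_3_6.exists_isWeilGroundState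
      ConnesConsaniMoscovici2025_thm_3_6_holds ha
    exact (hasDerivAt_weilGroundEnergy_of_virial_eq ha ha2 h hw).differentiableAt

/-- **The edge law at every small window with a unique virial**: `a · ε'(a) = −V(w)` for every
ground state `w`, as soon as the virial is constant on the ground states of `a` (no
differentiability hypothesis — compare `mul_deriv_weilGroundEnergy_eq_neg_virial_of_lt`).
[cite: Danskin1966, Thm 1] -/
theorem mul_deriv_weilGroundEnergy_eq_neg_virial_of_virial_eq {a : ℝ} (ha : 0 < a)
    (ha2 : a < Real.log 2 / 2)
    (h : ∀ u v, IsWeilGroundState a u → IsWeilGroundState a v →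
      weilSmallWindowVirial a u = weilSmallWindowVirial a v)
    {w : ℝ → ℂ} (hw : IsWeilGroundState a w) :
    a * deriv weilGroundEnergy a = -weilSmallWindowVirial a w := by
  rw [(hasDerivAt_weilGroundEnergy_of_virial_eq ha ha2 h hw).deriv]
  field_simp

end Summit.RiemannHypothesis.RiemannHypothesis.Theorems.PfPersistence

end
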